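import Mathlib
import HarnessLib
import Summits.FinalStateConjecture.Statement
import Literature.Geometry.Lorentzian.TrappedSurface
import Literature.Geometry.Lorentzian.KerrSurfaceGravity
import Literature.Geometry.Lorentzian.KerrSchild
import Literature.Geometry.Lorentzian.LocFinalStateSettling

/-!
# Route SpectralSurfaceGravity · crux `GenericRedShiftedSettling` (stmt-FinalStateConjecture-17368) —
# the typed decomposition and its PROVED assembly (crux-strategist, 2026-08-17)

The deciding crux G = `Theses.SpectralSurfaceGravity.GenericRedShiftedSettling` (tame-generically: every
MGHD has complete `𝓘⁺` AND an exhaustive, rays-closed, future-oriented `C²` final-state decomposition with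
closed labels `|aᵢ| ≤ Mᵢ` — convergence UNIFORM UP TO `r₊` — every hole of which carries a red-shifted
collar) was graded summit-or-harder by the route re-audit of 2026-08-17 (BC2). This module proves

  `genericRedShiftedSettling_of_subs : GenericCensoredCollars → CensoredLocSettling → CollarCompactness → G`

with the three hypotheses = the statements of the three sub-items verbatim (vocabulary:
`Literature/Geometry/Lorentzian/LocFinalStateSettling.lean`, p137806) and the conclusion = the body of the
route decl verbatim, so that the theorem is, by `δ/ζ`-unfolding only, the route's glue item (checked in a
scratch importing the route module: `example := (genericRedShiftedSettling_of_subs : _ → _ → _ →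
Theses.SpectralSurfaceGravity.GenericRedShiftedSettling)`, rc 0). This module does NOT import the route
module (D-0016 cycle rule: the route file imports the closing module for the `_holds` link).

## The cut (why these pieces)

Tame Christodoulou genericity is NOT closed under `∧` (one witness family per exceptional datum), so a
decomposition of a generic statement can contain at most ONE generic piece; everything else must be an
implication for ALL data. And the collar clause of G already asserts a `C⁴` extension of each hole chart
across `r = r₊` with eventually UNIFORM `C³` bounds on the pulled-back metric — so the passage from `C²`
convergence on compacta of the open exterior to `C²` convergence up to `r₊` is a compactness statement
(Arzelà–Ascoli on the translated slabs), not a red-shift estimate. Hence: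

* `GenericCensoredCollars` (crux, the generic core): tame-generically, complete `𝓘⁺` AND (if the exterior
  settles in `C²_loc` at all, it settles in `C²_loc` with red-shifted collars) — censorship + quasi-local
  third law; asserts NO settling. (The `∃ → ∃` form: "every `C²_loc` settling has collars" is refutable by
  re-parametrising hole charts near `r₊`.)
* `CensoredLocSettling` (crux, all data): every MGHD of admissible data WITH complete `𝓘⁺` settles in `C²_loc`
  (`CauchyDevelopment.IsLocSettling`: quasi-`⊤` chart geometry, shell convergence for every `δ > 0`, flat
  convergence, `exteriorOf`/`Rays`/excised-exhaustive/future-oriented clauses) with `|aᵢ| ≤ Mᵢ` — the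
  censored final-state theorem, extremal-agnostic (immune to the Aretakis instability).
* `CollarCompactness` (support, all spacetimes): late boosted-Kerr chart + `C⁴` collar extension reproducing
  it with `C³`-bounded pulled-back metric + shell convergence for every `δ > 0` ⇒ `truncDeviationCk … (r₊+δ₁) τ
  → 0` for some `δ₁ > 0`.

## The assembly (what happens BETWEEN the pieces)

Pointwise on admissible data, under `IsTameChristodoulouGeneric`-monotonicity: `GenericCensoredCollars` gives
complete `𝓘⁺` → `CensoredLocSettling` gives some `C²_loc` settling → back into `GenericCensoredCollars`: a
`C²_loc` settling WITH collars → per hole, three of the collar's fifteen clauses + the hole's shell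
convergence are the hypotheses of `CollarCompactness` → inner radius `r₊ᵢ + δ₁ᵢ` with convergence on
`{rᵢ ≤ r₊ᵢ + δ₁ᵢ}` → THE SEAM (`Spacetime.tendsto_truncDeviationCk_of_inner_of_annular`): for every radius,
fixed `R` or the growing honest radii `Rᵢ(τ)` of `HasLocExhaustiveCharts`, `{rᵢ ≤ R}` = inner slab ∪ shell
`{r₊ᵢ + δ₁ᵢ ≤ rᵢ ≤ R}`, so the near-zone `C²` deviation is `≤ max` of the two and tends to `0` → the SAME
charts form a `FinalStateDecomposition` (`QuasiFinalStateDecomposition.toFinalStateDecomposition`) whose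
charted / certified regions, motions and charts are those of `q` definitionally, so the four Statement
clauses and the collars transfer. BC2 probes (folder `bc/*_probe.lean`, 2026-08-17): for each piece `Xᵢ`,
`Xᵢ → FinalStateConjecture`, `Xᵢ → G`, `FinalStateConjecture → Xᵢ`, `G → Xᵢ` by
`first | exact? | simpa [Xᵢ] | (unfold Xᵢ; simpa) | aesop` all FAIL (12/12).

References: Dafermos–Luk arXiv:1710.01722, §1.2.1 and Conjecture 1 [DafermosLuk2017]; Christodoulou, CQG 16
(1999) A23, p. A24 [Christodoulou1999]; DHRT arXiv:2104.08222, §1 [arXiv210408222]; Andersson–Mars–Simon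
2008 [AnderssonMarsSimon2008]; Dafermos–Rodnianski arXiv:0811.0354, §3.3, §7.1 [DafermosRodnianski2008].
-/

/-! ===================== SPLIT (Summit side; final home: crux workfile / prover's closing module) ===================== -/

-- every `Summit.FinalStateConjecture.FinalStateConjecture.…` name repeats the summit = sub-problem segment (D-0017 layout)
set_option linter.dupNamespace false

noncomputable section

namespace Summit.FinalStateConjecture.FinalStateConjecture.Theorems.SpectralSurfaceGravity

open scoped BigOperators Topology Manifold Classical MeasureTheory ProbabilityTheory Matrix InnerProductSpace ComplexConjugate ContinuousMap
open Filter Set Function TopologicalSpace MeasureTheory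

/-- Tame Christodoulou genericity is monotone under pointwise implication on the admissible class (private
copy of `Literature.Geometry.Lorentzian.InitialDataSet.IsTameChristodoulouGeneric.mono`, module
`TameGenericityDiagonal`, kept local so that this module's import cone is the route's). [folklore] -/
private theorem tameGeneric_mono {X : Type} [TopologicalSpace X]
    [ChartedSpace Literature.Geometry.Lorentzian.E3 X] [IsManifold (𝓡 3) ((⊤ : ℕ∞) : WithTop ℕ∞) X]
    {𝓓 : Set (Literature.Geometry.Lorentzian.InitialDataSet (𝓡 3) X)}
    {P Q : Literature.Geometry.Lorentzian.InitialDataSet (𝓡 3) X → Prop}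
    (h : Literature.Geometry.Lorentzian.InitialDataSet.IsTameChristodoulouGeneric 𝓓 P 1)
    (hPQ : ∀ d ∈ 𝓓, P d → Q d) :
    Literature.Geometry.Lorentzian.InitialDataSet.IsTameChristodoulouGeneric 𝓓 Q 1 := by
  intro d hd
  obtain ⟨e, F, hF, himm, h0, hinj, hD, hE⟩ := h d ⟨hd.1, fun hP ↦ hd.2 (hPQ d hd.1 hP)⟩
  exact ⟨e, F, hF, himm, h0, hinj, hD,
    fun c hc hmem ↦ hE c hc ⟨hmem.1, fun hP ↦ hmem.2 (hPQ _ hmem.1 hP)⟩⟩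

/-- **`GenericRedShiftedSettling` from its three pieces** (crux-strategist decomposition, 2026-08-17):
`GenericCensoredCollars → CensoredLocSettling → CollarCompactness → GenericRedShiftedSettling`, hypotheses =
the three sub-items' statements verbatim, conclusion = the body of the route decl
`Theses.SpectralSurfaceGravity.GenericRedShiftedSettling` verbatim (so that the implication is, by
`δ/ζ`-unfolding only, the route's glue item; this module does not import the route module — cycle rule).

Proof. Fix `X`. Tame genericity is monotone in the property (`tameGeneric_mono`), so it suffices to derive
the crux's generic property `Q D` := "every MGHD has complete `𝓘⁺` and an exhaustive, rays-closed,
future-oriented `C²` decomposition with closed labels all of whose holes carry red-shifted collars" from the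
generic property of `GenericCensoredCollars` POINTWISE on admissible data, using the two `∀`-data pieces:
for an MGHD `𝒟`, `GenericCensoredCollars` gives complete `𝓘⁺`; `CensoredLocSettling` turns complete `𝓘⁺`
into SOME `C²_loc` settling `(O, q)`; fed back into `GenericCensoredCollars` this yields a `C²_loc` settling
`(O, q)` WITH collars; for each hole `i`, the collar's chart-extension sub-clauses (`C⁴` on the coordinate
collar, reproducing `chart i`, eventually `C³`-bounded metric) and the excised convergence of hole `i` are
exactly the hypotheses of `CollarCompactness`, which returns a radius `r₊ᵢ + δ₁ᵢ` out to which the near-zone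
deviation tends to `0`; the SEAM: for every radius `R` (fixed, or the growing honest radii `Rᵢ(τ)` of
`HasLocExhaustiveCharts`) the truncated slab `{rᵢ ≤ R}` is the inner slab `{rᵢ ≤ r₊ᵢ + δ₁ᵢ}` plus the shell
`{r₊ᵢ + δ₁ᵢ ≤ rᵢ ≤ R}`, so the near-zone `C²` deviation is `≤ max` of the two and tends to `0`
(`Spacetime.tendsto_truncDeviationCk_of_inner_of_annular`); with horizon-uniform convergence in hand the
SAME charts form a `FinalStateDecomposition` (`QuasiFinalStateDecomposition.toFinalStateDecomposition`),
whose charted region, certified regions, motions and charts are those of `q` definitionally, so the four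
Statement clauses and the collars transfer verbatim. [folklore] -/
theorem genericRedShiftedSettling_of_subs
    (h₁ : ∀ (X : Type) [TopologicalSpace X] [ChartedSpace Literature.Geometry.Lorentzian.E3 X] [IsManifold (𝓡 3) ((⊤ : ℕ∞) : WithTop ℕ∞) X] [T2Space X] [SecondCountableTopology X] [ConnectedSpace X], Literature.Geometry.Lorentzian.InitialDataSet.IsTameChristodoulouGeneric (Literature.Geometry.Lorentzian.admissibleVacuumData X) (fun D ↦ ∀ 𝒟 : Literature.Geometry.Lorentzian.VacuumCauchyDevelopment D, 𝒟.IsMaximal → Summit.FinalStateConjecture.HasCompleteNullInfinity 𝒟.toCauchyDevelopment ∧ ((∃ (O : Set 𝒟.carrier) (q : Literature.Geometry.Lorentzian.QuasiFinalStateDecomposition 𝒟.toSpacetime O 2 ⊤), 𝒟.toCauchyDevelopment.IsLocSettling O q) → ∃ (O : Set 𝒟.carrier) (q : Literature.Geometry.Lorentzian.QuasiFinalStateDecomposition 𝒟.toSpacetime O 2 ⊤), 𝒟.toCauchyDevelopment.IsLocSettling O q ∧ ∀ i, 𝒟.toSpacetime.RedShiftedCollarC4 (q.motion i).1 (q.motion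 i).2 (q.mass i) (q.spin i) q.τ₀ (q.chart i))) 1)
    (h₂ : ∀ (X : Type) [TopologicalSpace X] [ChartedSpace Literature.Geometry.Lorentzian.E3 X] [IsManifold (𝓡 3) ((⊤ : ℕ∞) : WithTop ℕ∞) X] [T2Space X] [SecondCountableTopology X] [ConnectedSpace X], ∀ D ∈ Literature.Geometry.Lorentzian.admissibleVacuumData X, ∀ 𝒟 : Literature.Geometry.Lorentzian.VacuumCauchyDevelopment D, 𝒟.IsMaximal → Summit.FinalStateConjecture.HasCompleteNullInfinity 𝒟.toCauchyDevelopment → ∃ (O : Set 𝒟.carrier) (q : Literature.Geometry.Lorentzian.QuasiFinalStateDecomposition 𝒟.toSpacetime O 2 ⊤), 𝒟.toCauchyDevelopment.IsLocSettling O q)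
    (h₃ : ∀ (𝓢 : Literature.Geometry.Lorentzian.Spacetime.{0} 4) (Λ : Literature.Geometry.Lorentzian.lorentzGroup) (c : Literature.Geometry.Lorentzian.E4) (M a τ₀ : ℝ) (O : Set 𝓢.carrier) (chart : Literature.Geometry.Lorentzian.boostedKerrExterior Λ c M a → 𝓢.carrier), 0 < M → |a| ≤ M → 𝓢.IsLateChart (Literature.Geometry.Lorentzian.boostedKerrBackground Λ c M a) O τ₀ chart → (∃ (η B τ₁ : ℝ) (Φ : Literature.Geometry.Lorentzian.E4 → 𝓢.carrier), 0 < η ∧ let C : Set Literature.Geometry.Lorentzian.E4 := {z | τ₀ < z 0 ∧ |Literature.Geometry.Lorentzian.Kerr.radius a z - Literature.Geometry.Lorentzian.Kerr.rPlus M a| < η}; let gC : Literature.Geometry.Lorentzian.E4 → Literature.Geometry.Lorentzian.E4 →L[ℝ] Literature.Geometry.Lorentzian.E4 →L[ℝ] ℝ := fun z ↦ Literature.Geometry.Lorentzian.pullbackBilin (I := 𝓡 4) (I' := 𝓘(ℝ, Literature.Geometry.Lorentzian.E4)) Φ 𝓢.metric.val z; ContMDiffOn 𝓘(ℝ, Literature.Geometry.Lorentzian.E4)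 (𝓡 4) 4 Φ C ∧ EqOn chart (Φ ∘ Literature.Geometry.Lorentzian.poincareInv Λ c ∘ Subtype.val) {x | Literature.Geometry.Lorentzian.poincareInv Λ c x ∈ C} ∧ Literature.Geometry.Lorentzian.supCkENorm {z ∈ C | τ₁ ≤ z 0} 3 gC ≤ ENNReal.ofReal B) → (∀ δ R : ℝ, 0 < δ → Tendsto (fun τ ↦ 𝓢.annularDeviationCk (Literature.Geometry.Lorentzian.boostedKerrBackground Λ c M a) chart 2 (Literature.Geometry.Lorentzian.Kerr.rPlus M a + δ) R τ) atTop (𝓝 0)) → ∃ δ₁ : ℝ, 0 < δ₁ ∧ Tendsto (fun τ ↦ 𝓢.truncDeviationCk (Literature.Geometry.Lorentzian.boostedKerrBackground Λ c M a) chart 2 (Literature.Geometry.Lorentzian.Kerr.rPlus M a + δ₁) τ) atTop (𝓝 0)) :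
    let E4 := EuclideanSpace ℝ (Fin 4); let E3 := EuclideanSpace ℝ (Fin 3); let S2 := Metric.sphere (0 : E3) 1; let RSC := fun (𝓢 : Literature.Geometry.Lorentzian.Spacetime.{0} 4) (Λ : Literature.Geometry.Lorentzian.lorentzGroup) (c : E4) (M a τ₀ : ℝ) (chart : Literature.Geometry.Lorentzian.boostedKerrExterior Λ c M a → 𝓢.carrier) => ∃ (η κ m b B τ₁ : ℝ) (Φ : E4 → 𝓢.carrier) (ρ : ℝ → E3 → ℝ), 0 < η ∧ 0 < κ ∧ 0 < m ∧ 0 < b ∧ let r := Literature.Geometry.Lorentzian.Kerr.radius a; let C : Set E4 := {z | τ₀ < z 0 ∧ |r z - Literature.Geometry.Lorentzian.Kerr.rPlus M a| < η}; let gC : E4 → E4 →L[ℝ] E4 →L[ℝ] ℝ := fun z ↦ Literature.Geometry.Lorentzian.pullbackBilin (I := 𝓡 4) (I' := 𝓘(ℝ, E4)) Φ 𝓢.metric.val z; let sec : ℝ → S2 → E4 := fun τ n ↦ Literature.Geometry.Lorentzian.E4.ofTimeSpace τ (ρ τ n • (n : E3)); let A := Ioi τ₁ ×ˢ {y : E3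 | 2⁻¹ < ‖y‖ ∧ ‖y‖ < 2}; let T := (fun q : ℝ × S2 ↦ Φ (sec q.1 q.2)) '' (Ioi τ₁ ×ˢ univ); ContMDiffOn 𝓘(ℝ, E4) (𝓡 4) 4 Φ C ∧ Topology.IsOpenEmbedding (C.restrict Φ) ∧ EqOn chart (Φ ∘ Literature.Geometry.Lorentzian.poincareInv Λ c ∘ Subtype.val) {x | Literature.Geometry.Lorentzian.poincareInv Λ c x ∈ C} ∧ Literature.Geometry.Lorentzian.supCkENorm {z ∈ C | τ₁ ≤ z 0} 3 gC ≤ ENNReal.ofReal B ∧ (∀ z ∈ C, τ₁ ≤ z 0 → (∀ v : E4, v 0 = 0 → b * ‖v‖ ^ 2 ≤ gC z v v) ∧ ∃ w : E4, ‖w‖ ≤ 1 ∧ gC z w w ≤ -b) ∧ ContDiffOn ℝ 4 (uncurry ρ) A ∧ Literature.Geometry.Lorentzian.supCkENorm A 4 (uncurry ρ) ≤ ENNReal.ofReal B ∧ (∀ τ, τ₁ < τ → ∀ n : S2, sec τ n ∈ C) ∧ (∀ ε > (0 : ℝ), ∃ τ₂ : ℝ, ∀ τ, τ₂ < τ → ∀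 n : S2, Literature.Geometry.Lorentzian.Kerr.rPlus M a - ε < r (sec τ n)) ∧ (∀ p ∈ T, ∀ q ∈ T, q ∉ 𝓢.metric.chronologicalFuture 𝓢.timeOrientation {p}) ∧ (∀ τ, τ₁ < τ → ∀ [𝓢.metric.HasLeviCivita], ∀ hpb, ∃ (ψ : S2 → ℝ) (F : ℝ → S2 → 𝓢.carrier) (P : ∀ s, Literature.Geometry.Lorentzian.LorentzianMetric.NullNormalPair (𝓡 2) 𝓢.metric 𝓢.timeOrientation (F s)) (hF : ∀ s, 𝓢.metric.IsSpacelikeImmersion (𝓡 2) (F s)), (F 0 = fun n ↦ Φ (sec τ n)) ∧ ContMDiff (𝓘(ℝ, ℝ).prod (𝓡 2)) (𝓡 4) 3 (uncurry F) ∧ ContMDiff (𝓘(ℝ, ℝ).prod (𝓡 2)) (𝓡 4).tangent 0 (fun p : ℝ × S2 ↦ (Bundle.TotalSpace.mk' E4 (F p.1 p.2) ((P p.1).L p.2) : TangentBundle (𝓡 4) 𝓢.carrier)) ∧ 𝓢.metric.IsMarginallyTrapped hpb (hF 0) (P 0) ∧ (∀ n, m ≤ ψ n ∧ ψ n ≤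 1) ∧ (∀ n, ∃ v : E4, v 0 = 1 ∧ mfderiv 𝓘(ℝ, E4) (𝓡 4) Φ (sec τ n) v = (P 0).L n) ∧ (∀ n, mfderiv 𝓘(ℝ, ℝ) (𝓡 4) (fun s ↦ F s n) 0 1 = (-(ψ n)) • (P 0).Lbar n) ∧ (∀ n, ∃ D : ℝ, HasDerivAt (fun s ↦ 𝓢.metric.nullExpansion (F s) hpb (hF s) (P s).L n) D 0 ∧ κ * (-(𝓢.metric.nullExpansion (F 0) hpb (hF 0) (P 0).Lbar n)) * ψ n ≤ D)); let RS := fun (X : Type) [TopologicalSpace X] [ChartedSpace E3 X] [IsManifold (𝓡 3) ((⊤ : ℕ∞) : WithTop ℕ∞) X] [ConnectedSpace X] (D : Literature.Geometry.Lorentzian.InitialDataSet (𝓡 3) X) (𝒟 : Literature.Geometry.Lorentzian.VacuumCauchyDevelopment D) => ∃ (O : Set 𝒟.carrier) (d : Literature.Geometry.Lorentzian.FinalStateDecomposition 𝒟.toSpacetime O 2), O = Summit.FinalStateConjecture.exteriorOf 𝒟.toCauchyDevelopment d.charted ∧ Summit.FinalStateConjecture.RaysStayInClosure 𝒟.toCauchyDevelopment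 O ∧ Summit.FinalStateConjecture.HasExhaustiveCharts d ∧ Summit.FinalStateConjecture.IsFutureOriented d ∧ ∀ i, RSC 𝒟.toSpacetime (d.motion i).1 (d.motion i).2 (d.mass i) (d.spin i) d.τ₀ (d.chart i); ∀ (X : Type) [TopologicalSpace X] [ChartedSpace E3 X] [IsManifold (𝓡 3) ((⊤ : ℕ∞) : WithTop ℕ∞) X] [T2Space X] [SecondCountableTopology X] [ConnectedSpace X], Literature.Geometry.Lorentzian.InitialDataSet.IsTameChristodoulouGeneric (Literature.Geometry.Lorentzian.admissibleVacuumData X) (fun D ↦ ∀ 𝒟 : Literature.Geometry.Lorentzian.VacuumCauchyDevelopment D, 𝒟.IsMaximal → Summit.FinalStateConjecture.HasCompleteNullInfinity 𝒟.toCauchyDevelopment ∧ RS X D 𝒟) 1 := by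
  intro E4 E3 S2 RSC RS X _ _ _ _ _ _
  refine tameGeneric_mono (h₁ X) ?_
  intro D hD hQ 𝒟 h𝒟
  obtain ⟨hscri, hup⟩ := hQ 𝒟 h𝒟
  obtain ⟨O, q, hloc, hcoll⟩ := hup (h₂ X D hD 𝒟 h𝒟 hscri)
  refine ⟨hscri, ?_⟩
  obtain ⟨hconv, hflat, hO, hrays, ⟨R, hR, hgrow, hcov⟩, hfo⟩ := hloc
  -- the collar of each hole feeds `CollarCompactness`
  have key : ∀ i : Fin q.N, ∃ δ₁ : ℝ, 0 < δ₁ ∧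
      Tendsto (fun τ ↦ 𝒟.toSpacetime.truncDeviationCk (q.background i) (q.chart i) 2
        (Literature.Geometry.Lorentzian.Kerr.rPlus (q.mass i) (q.spin i) + δ₁) τ) atTop (𝓝 0) := by
    intro i
    obtain ⟨η, κ, m, b, B, τ₁, Φ, ρ, hη, -, -, -, hC⟩ := hcoll i
    obtain ⟨hc1, -, hc3, hc4, -⟩ := hC
    exact h₃ 𝒟.toSpacetime (q.motion i).1 (q.motion i).2 (q.mass i) (q.spin i) q.τ₀ O (q.chart i)
      (q.mass_pos i) (q.abs_spin_le_mass i) (q.isLateChart i) ⟨η, B, τ₁, Φ, hη, hc1, hc3, hc4⟩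
      (fun δ R' hδ ↦ hconv i δ R' hδ)
  choose δ₁ hδ₁ hinner using key
  -- the seam: near-zone deviation ≤ max(inner collar part, excised shell), for fixed and for growing radii
  have hfixed : ∀ (i : Fin q.N) (R' : ℝ),
      Tendsto (fun τ ↦ 𝒟.toSpacetime.truncDeviationCk (q.background i) (q.chart i) 2 R' τ) atTop (𝓝 0) :=
    fun i R' ↦ 𝒟.toSpacetime.tendsto_truncDeviationCk_of_inner_of_annular (q.background i) (q.chart i) 2
      _ (fun _ ↦ R') (hinner i) (hconv i (δ₁ i) R' (hδ₁ i))
  have hgrowing : ∀ i : Fin q.N,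
      Tendsto (fun τ ↦ 𝒟.toSpacetime.truncDeviationCk (q.background i) (q.chart i) 2 (R i τ) τ) atTop (𝓝 0) :=
    fun i ↦ 𝒟.toSpacetime.tendsto_truncDeviationCk_of_inner_of_annular (q.background i) (q.chart i) 2
      _ (R i) (hinner i) (hgrow i (δ₁ i) (hδ₁ i))
  -- rebuild the decomposition in the SAME charts and transfer the clauses
  exact ⟨O, q.toFinalStateDecomposition hfixed hflat, hO, hrays, ⟨R, hR, hgrowing, hcov⟩, hfo, hcoll⟩

end Summit.FinalStateConjecture.FinalStateConjecture.Theorems.SpectralSurfaceGravity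

end
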